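import Summits.CriticalPhenomena.SAWScalingLimit.Theorems.SAWMassiveIsingTiltLatticeUniversalityKernelUnderTransport
import Summits.CriticalPhenomena.SAWScalingLimit.Theorems.SAWMassiveIsingTiltLatticeUniversalityThirdEndpoints
import Mathlib.MeasureTheory.Measure.HasOuterApproxClosed
import HarnessLib

/-!
# Crux `LatticeUniversality` (stmt-CriticalPhenomena-0807), line `registered` (birth v4.1) — the kernel PINNED:
# granted route SAWTrackTransport's three items, VCR (equivalently K2∀) is EQUIVALENT to the crux

Line lead c5 (prover-line-stmt-CriticalPhenomena-0807-c5-0, 2026-08-17), `--supports stmt-CriticalPhenomena-0807`.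

Skeleton v4.1 of the line (`Cruxes/LatticeUniversality/Lines/birth.lean`) closes the crux from four statements,

  VCR (`stub_hexVertexRobust`) → `RobustSquareLimit` (= conjunct (ii) of stmt-16995) → `AngleUniversality`
  (= stmt-16963) → `YBtoUniform` (= stmt-16966) → `LatticeUniversality`

(`latticeUniversality_of_vcr_robustSquare`, p161241), where (HexVL)(P) := "for every Dobrushin domain `D` and every
hexagonal endpoint approximation of `D`, the critical hexagonal chordal law of `D` in the VERTEX convention, pushed along
the quarter turn `σ z = i z`, converges in law to `P (σD)`" and VCR := `∀ P chordal, RL(π/3) P → (HexVL)(P)`. Lead c4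
showed that VCR is the weakest kernel SUFFICIENT on this line and that K2∀ ↔ VCR granted a chordal robust `π/3` limit
(`allForm_iff_vcr`, p157333). This file pins the kernel from BELOW:

* `tendstoLaw_hexLaw_of_latticeUniversality_toll` — **LatticeUniversality → YBtoUniform → RL(π/2) P → (HexVL)(P)**:
  the crux and the toll transport EVERY robust square-tiling limit `P` to the vertex-convention hexagonal laws (exact
  quarter turn at the `δℤ²` end, `integral_quarterTurn` p143793; the toll in `σD` along the landed compass approximation;
  `RL(π/2)` at `u ≡ 0`, `tendstoLaw_of_robustLimit`; subtract the crux tested on `f ∘ σ`). No `AngleUniversality`, no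
  chordality, no tightness, no (A).
* `eq_of_robustLimit` — two chordal robust limits of the critical Glazman–Manolescu walk at one angle `α ∈ [π/3, 2π/3]`
  COINCIDE on every Dobrushin domain (admissible endpoints exist at every such angle, `ybEndpoints_of_mem_Icc`; weak
  limits along the proper filter `𝓝[>] 0` are unique; finite Borel measures on the metric space `CurveClass ℂ` with equal
  bounded continuous integrals are equal).
* `hexVertexRobust_of_latticeUniversality` — **LatticeUniversality → RobustSquareLimit → AngleUniversality → YBtoUniform
  → VCR**; with p161241, `latticeUniversality_iff_hexVertexRobust` and (through `allForm_iff_vcr`)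
  `latticeUniversality_iff_allForm`:

      RobustSquareLimit → AngleUniversality → YBtoUniform → (LatticeUniversality ↔ VCR ↔ K2∀).

  So on the Yang–Baxter relay the hexagonal kernel cannot be weakened below VCR: granted route SAWTrackTransport's items
  16995 (ii), 16963, 16966 it IS the crux, and filing VCR (or K2∀) as an item is filing "0807 modulo SAWTrackTransport".
* By-products: `hexEndpointMerging_of_latticeUniversality` (endpoint robustness of the critical hexagonal chordal law in
  merging form is a COROLLARY of the crux alone — the part (E) of the kernel is intrinsic to 0807, whatever the line);
  `hexLimit_of_latticeUniversality_toll` (crux + toll + a robust square-tiling limit ⇒ the vertex-convention critical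
  hexagonal SAW has a full chordal scaling limit, `D ↦ P (σD)` seen through `σ` — no `AngleUniversality`).

Everything proved, standard axioms; no named fact is used. [folklore]
-/

noncomputable section

namespace Summit.CriticalPhenomena.SAWScalingLimit.Cruxes.LatticeUniversality.Birth

open MeasureTheory Filter Topology Set
open scoped NNReal ENNReal BoundedContinuousFunction
open Complex (I I_ne_zero)
open Literature.Probability.RandomPlanarGeometry
open Literature.Probability.RandomPlanarGeometry.SAW
open Literature.Probability.RandomPlanarGeometry.SAW.YangBaxter
open Literature.Probability.LatticeModels (Site HexVertex hexGraph hexCenter)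
open Summit.CriticalPhenomena.SAWScalingLimit.Theses
open Summit.CriticalPhenomena.SAWScalingLimit.Cruxes.HexTransfer.YbRelay (third IsBdryEdge bdryVertex
  faceDomain gmSimilarity)

/-! ### The crux and the toll transport every robust square-tiling limit to the vertex-convention hexagonal laws -/

/-- **LatticeUniversality → YBtoUniform → RL(π/2) P → (HexVL)(P).** Let `P` be any family of laws that is the robust
full limit on the square tiling of the critical Glazman–Manolescu walk (`RL(π/2) P`, route SAWTrackTransport's
hypothesis written out). If the crux `LatticeUniversality` (route `SAWMassiveIsingTilt`'s spelling) and the toll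
`YBtoUniform` (stmt-16966) hold, then for every Dobrushin domain `D` and every hexagonal endpoint approximation
`(a', b')` of `D`, the critical hexagonal chordal law of `D` between `a' δ, b' δ` (vertex convention), pushed along the
quarter turn `σ z = i z`, converges in law to `P (σD)`. Proof, for a test function `F`: pick a `δℤ²` endpoint
approximation `(a, b)` of `D` (`SAW.exists_isEndpointApprox`); `∫ F∘σ dP^{ℤ²}_δ(D; a, b) = ∫ F dP^{ℤ²}_δ(σD; σa, σb)`
exactly (`integral_quarterTurn`); the toll merges the latter on `C_b` with the square-tiling law of `σD` along the
landed compass approximation, which converges to `P (σD)` (`RL(π/2)` at `u ≡ 0`, `tendstoLaw_of_robustLimit`); and the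
crux tested on `F ∘ σ` merges `P^{ℤ²}_δ(D; a, b)` with `P^{Hex}_δ(D; a', b')`. [folklore] -/
theorem tendstoLaw_hexLaw_of_latticeUniversality_toll (hU : SAWMassiveIsingTilt.LatticeUniversality)
    (h4 : SAWTrackTransport.YBtoUniform) (P : ChordalFamily)
    (hRL2 : ∀ (D : DobrushinDomain) (u : ℝ → ℂ) (a b : ℝ → MidEdge),
      (∀ᶠ δ in 𝓝[>] (0 : ℝ), ‖u δ‖ ≤ δ) →
      (∀ᶠ δ in 𝓝[>] (0 : ℝ), Nonempty (YangBaxterSAW (fun (_ : ℤ) => Real.pi / 2)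
        ((D.map (similarity 1 one_ne_zero (u δ))).carrier) δ (a δ) (b δ))) →
      Tendsto (fun δ : ℝ => (δ : ℂ) * planeMidpoint (fun (_ : ℤ) => Real.pi / 2) (a δ)) (𝓝[>] (0 : ℝ))
        (𝓝 (D.pt 0)) →
      Tendsto (fun δ : ℝ => (δ : ℂ) * planeMidpoint (fun (_ : ℤ) => Real.pi / 2) (b δ)) (𝓝[>] (0 : ℝ))
        (𝓝 (D.pt 1)) →
      TendstoLaw (fun δ (γ : YangBaxterSAW (fun (_ : ℤ) => Real.pi / 2)
          ((D.map (similarity 1 one_ne_zero (u δ))).carrier) δ (a δ) (b δ)) =>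
          γ.curve (fun (_ : ℤ) => Real.pi / 2) δ)
        (fun δ => ybLaw (fun (_ : ℤ) => Real.pi / 2) ((D.map (similarity 1 one_ne_zero (u δ))).carrier) δ 1
          (a δ) (b δ)) id (P D))
    (D : DobrushinDomain) (a' b' : ℝ → HexVertex) (hab' : SAW.IsEmbEndpointApprox hexGraph hexCenter D a' b') :
    TendstoLaw (fun δ (γ : SAW.HexDomainSAW D.carrier δ (a' δ) (b' δ)) =>
        CurveClass.map (similarity I I_ne_zero 0 : C(ℂ, ℂ)) γ.curve)
      (fun δ => SAW.hexSAWLaw D.carrier δ (a' δ) (b' δ)) id (P (D.map (similarity I I_ne_zero 0))) := by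
  intro F
  -- a `δℤ²` approximation of `D`, its quarter turn (an approximation of `σD`), the compass approximation of `σD`
  obtain ⟨a, b, hab⟩ := SAW.exists_isEndpointApprox D
  have habσ := Cruxes.HexTransfer.PinTheShear.stub_quarterTurnCovariance.2 D a b hab
  obtain ⟨a₂, b₂, hab₂⟩ :=
    Cruxes.HexTransfer.Sketch.stub_compassEndpoints (D.map (similarity I I_ne_zero 0))
  -- the test function pulled back along `σ`
  set Fσ : BoundedContinuousFunction (CurveClass ℂ) ℝ := F.compContinuous
    ⟨CurveClass.map (similarity I I_ne_zero 0 : C(ℂ, ℂ)),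
      (CurveClass.lipschitzWith_map (lipschitzWith_similarity I I_ne_zero 0)).continuous⟩ with hFσ_def
  have hFσ : ∀ c, Fσ c = F (CurveClass.map (similarity I I_ne_zero 0 : C(ℂ, ℂ)) c) := fun c => by
    simp only [hFσ_def, BoundedContinuousFunction.compContinuous_apply, ContinuousMap.coe_mk]
  -- bracket 1: the crux on `F ∘ σ`
  have hX := hU D a b a' b' hab hab' Fσ
  -- bracket 2: the toll in `σD` on `F`
  have hZ := h4 (D.map (similarity I I_ne_zero 0)) (fun δ => ![-(a δ 1), a δ 0])
    (fun δ => ![-(b δ 1), b δ 0]) a₂ b₂ habσ hab₂ F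
  -- bracket 3: the square-tiling laws of `σD` converge to `P (σD)` (robust limit at `u ≡ 0`)
  have h2 := Cruxes.HexTransfer.YbRelay.tendstoLaw_of_robustLimit (Real.pi / 2) P hRL2
    (D.map (similarity I I_ne_zero 0)) a₂ b₂ hab₂ F
  -- assemble: `∫ F∘σ dHex = ∫ F dyb + (∫ F dZ²(σD) − ∫ F dyb) − (∫ F∘σ dZ²(D) − ∫ F∘σ dHex)`, quarter turn exact
  have h := (h2.add hZ).sub hX
  rw [add_zero, sub_zero] at h
  refine h.congr fun δ => ?_
  have hq : ∫ γ, F γ.curve ∂(SAW.law (D.map (similarity I I_ne_zero 0)).carrier δ ![-(a δ 1), a δ 0]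
      ![-(b δ 1), b δ 0]) = ∫ γ, F (CurveClass.map (similarity I I_ne_zero 0 : C(ℂ, ℂ)) γ.curve)
        ∂(SAW.law D.carrier δ (a δ) (b δ)) :=
    integral_quarterTurn D.carrier δ (a δ) (b δ) F
  simp only [hFσ] at hq ⊢
  linarith [hq]

/-- **The crux, the toll and a robust square-tiling limit give the VERTEX-convention critical hexagonal SAW a full
chordal scaling limit** — every Dobrushin domain, every hexagonal endpoint approximation; the limit is `D ↦ P (σD)` seen
through the quarter turn `σ` (unidentified). Compare `hexLimit_of_allForm_robustSquare` (K2∀ + robust square limit +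
`AngleUniversality`): here no `AngleUniversality` is needed. [folklore] -/
theorem hexLimit_of_latticeUniversality_toll (hU : SAWMassiveIsingTilt.LatticeUniversality)
    (h4 : SAWTrackTransport.YBtoUniform)
    (hL : ∃ P : ChordalFamily, P.IsChordal ∧ ∀ (D : DobrushinDomain) (u : ℝ → ℂ) (a b : ℝ → MidEdge), (∀ᶠ δ in 𝓝[>] (0 : ℝ), ‖u δ‖ ≤ δ) → (∀ᶠ δ in 𝓝[>] (0 : ℝ), Nonempty (YangBaxterSAW (fun (_ : ℤ) => Real.pi / 2) ((D.map (similarity 1 one_ne_zero (u δ))).carrier) δ (a δ) (b δ))) → Tendsto (fun δ : ℝ => (δ : ℂ) * planeMidpoint (fun (_ : ℤ) => Real.pi / 2) (a δ)) (𝓝[>] (0 : ℝ)) (𝓝 (D.pt 0)) → Tendsto (fun δ : ℝ => (δ : ℂ) * planeMidpoint (fun (_ : ℤ) => Real.pi / 2) (b δ)) (𝓝[>] (0 : ℝ)) (𝓝 (D.pt 1)) → TendstoLaw (fun δ (γ : YangBaxterSAW (fun (_ : ℤ) => Real.pi / 2) ((D.map (similarity 1 one_ne_zero (u δ))).carrier)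 δ (a δ) (b δ)) => γ.curve (fun (_ : ℤ) => Real.pi / 2) δ) (fun δ => ybLaw (fun (_ : ℤ) => Real.pi / 2) ((D.map (similarity 1 one_ne_zero (u δ))).carrier) δ 1 (a δ) (b δ)) id (P D)) :
    ∃ P : ChordalFamily, P.IsChordal ∧ ∀ (D : DobrushinDomain) (a b : ℝ → HexVertex),
      SAW.IsEmbEndpointApprox hexGraph hexCenter D a b →
      TendstoLaw (fun δ (γ : SAW.HexDomainSAW D.carrier δ (a δ) (b δ)) =>
          CurveClass.map (similarity I I_ne_zero 0 : C(ℂ, ℂ)) γ.curve)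
        (fun δ => SAW.hexSAWLaw D.carrier δ (a δ) (b δ)) id (P (D.map (similarity I I_ne_zero 0))) := by
  obtain ⟨P, hPch, hRL2⟩ := hL
  exact ⟨P, hPch, tendstoLaw_hexLaw_of_latticeUniversality_toll hU h4 P hRL2⟩

/-! ### Robust limits of the critical Glazman–Manolescu walk are unique -/

/-- **Two chordal robust limits at one angle coincide.** If `P` and `P'` are chordal families and both are robust full
limits `RL(α) P`, `RL(α) P'` of the critical Glazman–Manolescu walk at a constant angle `α ∈ [π/3, 2π/3]`, then
`P D = P' D` for every Dobrushin domain `D`: `D` admits an endpoint approximation at angle `α`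
(`ybEndpoints_of_mem_Icc`), along which the laws converge both to `P D` and to `P' D` (`tendstoLaw_of_robustLimit`);
limits along the proper filter `𝓝[>] 0` are unique, and two probability measures on the metric space `CurveClass ℂ`
with the same bounded continuous integrals are equal. [folklore] -/
theorem eq_of_robustLimit (α : ℝ) (hα : α ∈ Set.Icc (Real.pi / 3) (2 * Real.pi / 3)) (P P' : ChordalFamily)
    (hP : P.IsChordal) (hP' : P'.IsChordal)
    (hRL : ∀ (D : DobrushinDomain) (u : ℝ → ℂ) (a b : ℝ → MidEdge),
      (∀ᶠ δ in 𝓝[>] (0 : ℝ), ‖u δ‖ ≤ δ) →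
      (∀ᶠ δ in 𝓝[>] (0 : ℝ), Nonempty (YangBaxterSAW (fun (_ : ℤ) => α)
        ((D.map (similarity 1 one_ne_zero (u δ))).carrier) δ (a δ) (b δ))) →
      Tendsto (fun δ : ℝ => (δ : ℂ) * planeMidpoint (fun (_ : ℤ) => α) (a δ)) (𝓝[>] (0 : ℝ))
        (𝓝 (D.pt 0)) →
      Tendsto (fun δ : ℝ => (δ : ℂ) * planeMidpoint (fun (_ : ℤ) => α) (b δ)) (𝓝[>] (0 : ℝ))
        (𝓝 (D.pt 1)) →
      TendstoLaw (fun δ (γ : YangBaxterSAW (fun (_ : ℤ) => α)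
          ((D.map (similarity 1 one_ne_zero (u δ))).carrier) δ (a δ) (b δ)) =>
          γ.curve (fun (_ : ℤ) => α) δ)
        (fun δ => ybLaw (fun (_ : ℤ) => α) ((D.map (similarity 1 one_ne_zero (u δ))).carrier) δ 1
          (a δ) (b δ)) id (P D))
    (hRL' : ∀ (D : DobrushinDomain) (u : ℝ → ℂ) (a b : ℝ → MidEdge),
      (∀ᶠ δ in 𝓝[>] (0 : ℝ), ‖u δ‖ ≤ δ) →
      (∀ᶠ δ in 𝓝[>] (0 : ℝ), Nonempty (YangBaxterSAW (fun (_ : ℤ) => α)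
        ((D.map (similarity 1 one_ne_zero (u δ))).carrier) δ (a δ) (b δ))) →
      Tendsto (fun δ : ℝ => (δ : ℂ) * planeMidpoint (fun (_ : ℤ) => α) (a δ)) (𝓝[>] (0 : ℝ))
        (𝓝 (D.pt 0)) →
      Tendsto (fun δ : ℝ => (δ : ℂ) * planeMidpoint (fun (_ : ℤ) => α) (b δ)) (𝓝[>] (0 : ℝ))
        (𝓝 (D.pt 1)) →
      TendstoLaw (fun δ (γ : YangBaxterSAW (fun (_ : ℤ) => α)
          ((D.map (similarity 1 one_ne_zero (u δ))).carrier) δ (a δ) (b δ)) =>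
          γ.curve (fun (_ : ℤ) => α) δ)
        (fun δ => ybLaw (fun (_ : ℤ) => α) ((D.map (similarity 1 one_ne_zero (u δ))).carrier) δ 1
          (a δ) (b δ)) id (P' D))
    (D : DobrushinDomain) : P D = P' D := by
  haveI : IsProbabilityMeasure (P D) := (hP D).1
  haveI : IsProbabilityMeasure (P' D) := (hP' D).1
  obtain ⟨a, b, hab⟩ := Cruxes.HexTransfer.YbRelay.ybEndpoints_of_mem_Icc α hα D
  have h := Cruxes.HexTransfer.YbRelay.tendstoLaw_of_robustLimit α P hRL D a b hab
  have h' := Cruxes.HexTransfer.YbRelay.tendstoLaw_of_robustLimit α P' hRL' D a b hab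
  refine ext_of_forall_integral_eq_of_IsFiniteMeasure fun f => ?_
  simpa only [id] using tendsto_nhds_unique (h f) (h' f)

/-! ### The kernel pinned from below: the crux gives VCR back -/

/-- **LatticeUniversality → RobustSquareLimit → AngleUniversality → YBtoUniform → VCR** (the converse of the line's
composition `latticeUniversality_of_vcr_robustSquare`, p161241). Given a chordal `P` with `RL(π/3) P`, let `P₀` be the
chordal robust square-tiling limit; `AngleUniversality` makes `P₀` a robust `π/3` limit too, so `P (σD) = P₀ (σD)`
(`eq_of_robustLimit`); and (HexVL)(P₀) holds by `tendstoLaw_hexLaw_of_latticeUniversality_toll`. [folklore] -/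
theorem hexVertexRobust_of_latticeUniversality (hU : SAWMassiveIsingTilt.LatticeUniversality)
    (hL : ∃ P : ChordalFamily, P.IsChordal ∧ ∀ (D : DobrushinDomain) (u : ℝ → ℂ) (a b : ℝ → MidEdge), (∀ᶠ δ in 𝓝[>] (0 : ℝ), ‖u δ‖ ≤ δ) → (∀ᶠ δ in 𝓝[>] (0 : ℝ), Nonempty (YangBaxterSAW (fun (_ : ℤ) => Real.pi / 2) ((D.map (similarity 1 one_ne_zero (u δ))).carrier) δ (a δ) (b δ))) → Tendsto (fun δ : ℝ => (δ : ℂ) * planeMidpoint (fun (_ : ℤ) => Real.pi / 2) (a δ)) (𝓝[>] (0 : ℝ)) (𝓝 (D.pt 0)) → Tendsto (fun δ : ℝ => (δ : ℂ) * planeMidpoint (fun (_ : ℤ) => Real.pi / 2) (b δ)) (𝓝[>] (0 : ℝ)) (𝓝 (D.pt 1)) → TendstoLaw (fun δ (γ : YangBaxterSAW (fun (_ : ℤ) => Real.pi / 2) ((D.map (similarity 1 one_ne_zero (u δ))).carrier) δ (a δ) (b δ)) => γ.curve (fun (_ : ℤ) => Real.pi / 2) δ) (fun δ => ybLaw (fun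 (_ : ℤ) => Real.pi / 2) ((D.map (similarity 1 one_ne_zero (u δ))).carrier) δ 1 (a δ) (b δ)) id (P D))
    (hAU : SAWTrackTransport.AngleUniversality) (h4 : SAWTrackTransport.YBtoUniform) :
    ∀ P : ChordalFamily, P.IsChordal → (∀ (D : DobrushinDomain) (u : ℝ → ℂ) (a b : ℝ → MidEdge), (∀ᶠ δ in 𝓝[>] (0 : ℝ), ‖u δ‖ ≤ δ) → (∀ᶠ δ in 𝓝[>] (0 : ℝ), Nonempty (YangBaxterSAW (fun (_ : ℤ) => Real.pi / 3) ((D.map (similarity 1 one_ne_zero (u δ))).carrier) δ (a δ) (b δ))) → Tendsto (fun δ : ℝ => (δ : ℂ) * planeMidpoint (fun (_ : ℤ) => Real.pi / 3) (a δ)) (𝓝[>] (0 : ℝ)) (𝓝 (D.pt 0)) → Tendsto (fun δ : ℝ => (δ : ℂ) * planeMidpoint (fun (_ : ℤ) => Real.pi / 3) (b δ)) (𝓝[>] (0 : ℝ)) (𝓝 (D.pt 1)) → TendstoLaw (fun δ (γ : YangBaxterSAW (fun (_ : ℤ) => Real.pi / 3) ((D.map (similarity 1 one_ne_zero (u δ))).carrier)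 δ (a δ) (b δ)) => γ.curve (fun (_ : ℤ) => Real.pi / 3) δ) (fun δ => ybLaw (fun (_ : ℤ) => Real.pi / 3) ((D.map (similarity 1 one_ne_zero (u δ))).carrier) δ 1 (a δ) (b δ)) id (P D)) → ∀ (D : DobrushinDomain) (a b : ℝ → HexVertex), SAW.IsEmbEndpointApprox hexGraph hexCenter D a b → TendstoLaw (fun δ (γ : SAW.HexDomainSAW D.carrier δ (a δ) (b δ)) => CurveClass.map (similarity I I_ne_zero 0 : C(ℂ, ℂ)) γ.curve) (fun δ => SAW.hexSAWLaw D.carrier δ (a δ) (b δ)) id (P (D.map (similarity I I_ne_zero 0))) := by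
  intro P hPch hRL3 D a b hab
  obtain ⟨P₀, hP₀ch, hRL2₀⟩ := hL
  have hmem : Real.pi / 3 ∈ Set.Icc (Real.pi / 3) (2 * Real.pi / 3) := ⟨le_rfl, by linarith [Real.pi_pos]⟩
  have hRL3₀ := hAU (Real.pi / 3) hmem P₀ hP₀ch hRL2₀
  have hPP₀ : P (D.map (similarity I I_ne_zero 0)) = P₀ (D.map (similarity I I_ne_zero 0)) :=
    eq_of_robustLimit (Real.pi / 3) hmem P P₀ hPch hP₀ch hRL3 hRL3₀ _
  rw [hPP₀]
  exact tendstoLaw_hexLaw_of_latticeUniversality_toll hU h4 P₀ hRL2₀ D a b hab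

/-- **The kernel pinned**: granted route SAWTrackTransport's items `RobustSquareLimit` (conjunct (ii) of stmt-16995),
`AngleUniversality` (stmt-16963) and `YBtoUniform` (stmt-16966), the line's kernel VCR is EQUIVALENT to the crux
`LatticeUniversality` (→: `hexVertexRobust_of_latticeUniversality`; ←: the v4.1 composition
`latticeUniversality_of_vcr_robustSquare`, p161241). On the Yang–Baxter relay no weaker hexagonal kernel exists.
[folklore] -/
theorem latticeUniversality_iff_hexVertexRobust
    (hL : ∃ P : ChordalFamily, P.IsChordal ∧ ∀ (D : DobrushinDomain) (u : ℝ → ℂ) (a b : ℝ → MidEdge), (∀ᶠ δ in 𝓝[>] (0 : ℝ), ‖u δ‖ ≤ δ) → (∀ᶠ δ in 𝓝[>] (0 : ℝ), Nonempty (YangBaxterSAW (fun (_ : ℤ) => Real.pi / 2) ((D.map (similarity 1 one_ne_zero (u δ))).carrier) δ (a δ) (b δ))) → Tendsto (fun δ : ℝ => (δ : ℂ) * planeMidpoint (fun (_ : ℤ) => Real.pi / 2) (a δ)) (𝓝[>] (0 : ℝ)) (𝓝 (D.pt 0)) → Tendsto (fun δ : ℝ => (δ : ℂ) * planeMidpoint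 (fun (_ : ℤ) => Real.pi / 2) (b δ)) (𝓝[>] (0 : ℝ)) (𝓝 (D.pt 1)) → TendstoLaw (fun δ (γ : YangBaxterSAW (fun (_ : ℤ) => Real.pi / 2) ((D.map (similarity 1 one_ne_zero (u δ))).carrier) δ (a δ) (b δ)) => γ.curve (fun (_ : ℤ) => Real.pi / 2) δ) (fun δ => ybLaw (fun (_ : ℤ) => Real.pi / 2) ((D.map (similarity 1 one_ne_zero (u δ))).carrier) δ 1 (a δ) (b δ)) id (P D))
    (hAU : SAWTrackTransport.AngleUniversality) (h4 : SAWTrackTransport.YBtoUniform) :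
    SAWMassiveIsingTilt.LatticeUniversality ↔
      (∀ P : ChordalFamily, P.IsChordal → (∀ (D : DobrushinDomain) (u : ℝ → ℂ) (a b : ℝ → MidEdge), (∀ᶠ δ in 𝓝[>] (0 : ℝ), ‖u δ‖ ≤ δ) → (∀ᶠ δ in 𝓝[>] (0 : ℝ), Nonempty (YangBaxterSAW (fun (_ : ℤ) => Real.pi / 3) ((D.map (similarity 1 one_ne_zero (u δ))).carrier) δ (a δ) (b δ))) → Tendsto (fun δ : ℝ => (δ : ℂ) * planeMidpoint (fun (_ : ℤ) => Real.pi / 3) (a δ)) (𝓝[>] (0 : ℝ)) (𝓝 (D.pt 0)) → Tendsto (fun δ : ℝ => (δ : ℂ) * planeMidpoint (fun (_ : ℤ) => Real.pi / 3) (b δ)) (𝓝[>] (0 : ℝ)) (𝓝 (D.pt 1)) → TendstoLaw (fun δ (γ : YangBaxterSAW (fun (_ : ℤ) => Real.pi / 3) ((D.map (similarity 1 one_ne_zero (u δ))).carrier) δ (a δ) (b δ)) => γ.curve (fun (_ : ℤ) => Real.pi / 3) δ) (fun δ => ybLaw (fun (_ : ℤ) => Real.pi / 3) ((D.map (similarity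 1 one_ne_zero (u δ))).carrier) δ 1 (a δ) (b δ)) id (P D)) → ∀ (D : DobrushinDomain) (a b : ℝ → HexVertex), SAW.IsEmbEndpointApprox hexGraph hexCenter D a b → TendstoLaw (fun δ (γ : SAW.HexDomainSAW D.carrier δ (a δ) (b δ)) => CurveClass.map (similarity I I_ne_zero 0 : C(ℂ, ℂ)) γ.curve) (fun δ => SAW.hexSAWLaw D.carrier δ (a δ) (b δ)) id (P (D.map (similarity I I_ne_zero 0)))) :=
  ⟨fun hU => hexVertexRobust_of_latticeUniversality hU hL hAU h4,
    fun h1 => latticeUniversality_of_vcr_robustSquare h1 hL hAU h4⟩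

/-- **The kernel pinned, K2∀-typed**: granted the same three items, the ∀-form micro-robustness kernel K2∀ of skeleton
v3.3–v4 (`stub_hexMicroRobustAll`, promoted twice) is EQUIVALENT to the crux as well
(`latticeUniversality_iff_hexVertexRobust` + lead c4's `allForm_iff_vcr`, p157333, at the chordal robust `π/3` limit the
two transport items provide). [folklore] -/
theorem latticeUniversality_iff_allForm
    (hL : ∃ P : ChordalFamily, P.IsChordal ∧ ∀ (D : DobrushinDomain) (u : ℝ → ℂ) (a b : ℝ → MidEdge), (∀ᶠ δ in 𝓝[>] (0 : ℝ), ‖u δ‖ ≤ δ) → (∀ᶠ δ in 𝓝[>] (0 : ℝ), Nonempty (YangBaxterSAW (fun (_ : ℤ) => Real.pi / 2) ((D.map (similarity 1 one_ne_zero (u δ))).carrier) δ (a δ) (b δ))) → Tendsto (fun δ : ℝ => (δ : ℂ) * planeMidpoint (fun (_ : ℤ) => Real.pi / 2) (a δ)) (𝓝[>] (0 : ℝ)) (𝓝 (D.pt 0)) → Tendsto (fun δ : ℝ => (δ : ℂ) * planeMidpoint (fun (_ : ℤ) => Real.pi / 2) (b δ)) (𝓝[>] (0 : ℝ)) (𝓝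 (D.pt 1)) → TendstoLaw (fun δ (γ : YangBaxterSAW (fun (_ : ℤ) => Real.pi / 2) ((D.map (similarity 1 one_ne_zero (u δ))).carrier) δ (a δ) (b δ)) => γ.curve (fun (_ : ℤ) => Real.pi / 2) δ) (fun δ => ybLaw (fun (_ : ℤ) => Real.pi / 2) ((D.map (similarity 1 one_ne_zero (u δ))).carrier) δ 1 (a δ) (b δ)) id (P D))
    (hAU : SAWTrackTransport.AngleUniversality) (h4 : SAWTrackTransport.YBtoUniform) :
    SAWMassiveIsingTilt.LatticeUniversality ↔
      (∀ (D : DobrushinDomain) (a b : ℝ → HexVertex), SAW.IsEmbEndpointApprox hexGraph hexCenter D a b → ∀ a' b' : ℝ → MidEdge, (∀ᶠ δ in 𝓝[>] (0 : ℝ), a' δ ≠ b' δ ∧ IsBdryEdge (meshFaces third (((D.map (similarity I I_ne_zero 0)).map (similarity 1 one_ne_zero (-(I * (δ : ℂ) / 2)))).carrier) δ) (a' δ) ∧ IsBdryEdge (meshFaces third (((D.map (similarity I I_ne_zero 0)).map (similarity 1 one_ne_zero (-(I * (δ : ℂ) / 2)))).carrier) δ) (b' δ) ∧ Nonempty (YangBaxterSAW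 third (((D.map (similarity I I_ne_zero 0)).map (similarity 1 one_ne_zero (-(I * (δ : ℂ) / 2)))).carrier) δ (a' δ) (b' δ))) → Tendsto (fun δ : ℝ => (δ : ℂ) * planeMidpoint third (a' δ)) (𝓝[>] (0 : ℝ)) (𝓝 ((D.map (similarity I I_ne_zero 0)).pt 0)) → Tendsto (fun δ : ℝ => (δ : ℂ) * planeMidpoint third (b' δ)) (𝓝[>] (0 : ℝ)) (𝓝 ((D.map (similarity I I_ne_zero 0)).pt 1)) → ∀ f : BoundedContinuousFunction (CurveClass ℂ) ℝ, LipschitzWith 1 f → Tendsto (fun δ : ℝ => (∫ γ, f γ.curve ∂(SAW.hexSAWLaw (faceDomain (((D.map (similarity I I_ne_zero 0)).map (similarity 1 one_ne_zero (-(I * (δ : ℂ) / 2)))).carrier) δ (a' δ)) δ (bdryVertex (meshFaces third (((D.map (similarity I I_ne_zero 0)).map (similarity 1 one_ne_zero (-(I * (δ : ℂ) / 2)))).carrier) δ) (a' δ)) (bdryVertex (meshFaces third (((D.map (similarity I I_ne_zero 0)).map (similarity 1 one_ne_zero (-(I * (δ : ℂ) / 2)))).carrier) δ) (b' δ)))) -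 ∫ γ, f γ.curve ∂(SAW.hexSAWLaw D.carrier δ (a δ) (b δ))) (𝓝[>] (0 : ℝ)) (𝓝 0)) := by
  obtain ⟨P, hPch, hRL2⟩ := hL
  have hmem : Real.pi / 3 ∈ Set.Icc (Real.pi / 3) (2 * Real.pi / 3) := ⟨le_rfl, by linarith [Real.pi_pos]⟩
  have hex3 := allForm_iff_vcr ⟨P, hPch, hAU (Real.pi / 3) hmem P hPch hRL2⟩
  rw [hex3]
  exact latticeUniversality_iff_hexVertexRobust ⟨P, hPch, hRL2⟩ hAU h4

/-! ### What the crux alone says about the hexagonal model: endpoint robustness in merging form -/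

/-- **Endpoint robustness of the critical hexagonal chordal law is a corollary of the crux** (no other hypothesis):
for every Dobrushin domain `D` and any TWO hexagonal endpoint approximations `(a', b')`, `(a'', b'')` of `D`, the critical
hexagonal laws of `D` between `a' δ, b' δ` and between `a'' δ, b'' δ` merge on all bounded continuous test functions —
compare both with the `δℤ²` law of `D` along one `δℤ²` endpoint approximation (`SAW.exists_isEndpointApprox`) and
subtract. The part (E) "endpoint relocation" of the line's kernel is therefore intrinsic to stmt-0807, whatever the line.
[folklore] -/
theorem hexEndpointMerging_of_latticeUniversality (hU : SAWMassiveIsingTilt.LatticeUniversality)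
    (D : DobrushinDomain) (a' b' a'' b'' : ℝ → HexVertex)
    (hab' : SAW.IsEmbEndpointApprox hexGraph hexCenter D a' b')
    (hab'' : SAW.IsEmbEndpointApprox hexGraph hexCenter D a'' b'')
    (f : BoundedContinuousFunction (CurveClass ℂ) ℝ) :
    Tendsto (fun δ : ℝ => (∫ γ, f γ.curve ∂(SAW.hexSAWLaw D.carrier δ (a' δ) (b' δ))) -
        ∫ γ, f γ.curve ∂(SAW.hexSAWLaw D.carrier δ (a'' δ) (b'' δ))) (𝓝[>] (0 : ℝ)) (𝓝 0) := by
  obtain ⟨a, b, hab⟩ := SAW.exists_isEndpointApprox D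
  have h := (hU D a b a'' b'' hab hab'' f).sub (hU D a b a' b' hab hab' f)
  rw [sub_zero] at h
  exact h.congr fun δ => by ring

/-- **Endpoint robustness of the critical `δℤ²` chordal law is a corollary of the crux** likewise: any two `δℤ²`
endpoint approximations of `D` give merging laws — compare both with the hexagonal law of `D` along one hexagonal
endpoint approximation (`HexEndpointApprox.exists_isEmbEndpointApprox`, item 9864) and subtract. [folklore] -/
theorem sqEndpointMerging_of_latticeUniversality (hU : SAWMassiveIsingTilt.LatticeUniversality)
    (D : DobrushinDomain) (a b a₁ b₁ : ℝ → Site 2)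
    (hab : SAW.IsEndpointApprox D a b) (hab₁ : SAW.IsEndpointApprox D a₁ b₁)
    (f : BoundedContinuousFunction (CurveClass ℂ) ℝ) :
    Tendsto (fun δ : ℝ => (∫ γ, f γ.curve ∂(SAW.law D.carrier δ (a δ) (b δ))) -
        ∫ γ, f γ.curve ∂(SAW.law D.carrier δ (a₁ δ) (b₁ δ))) (𝓝[>] (0 : ℝ)) (𝓝 0) := by
  obtain ⟨a', b', hab'⟩ := Theorems.HexEndpointApprox.exists_isEmbEndpointApprox D
  have h := (hU D a b a' b' hab hab' f).sub (hU D a₁ b₁ a' b' hab₁ hab' f)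
  rw [sub_zero] at h
  exact h.congr fun δ => by ring

/-! ### Registered sub-goal (arrow form, for `--supports stmt-CriticalPhenomena-0807`) -/

/-- **Registered sub-goal** `hexVertexRobust_of_latticeUniversalityTrackTransport`: LatticeUniversality →
RobustSquareLimit → AngleUniversality → YBtoUniform → VCR — the converse of the v4.1 composition
`latticeUniversality_of_vcr_robustSquare`. [folklore] -/
theorem hexVertexRobust_of_latticeUniversalityTrackTransport : SAWMassiveIsingTilt.LatticeUniversality → (∃ P : ChordalFamily, P.IsChordal ∧ ∀ (D : DobrushinDomain) (u : ℝ → ℂ) (a b : ℝ → MidEdge), (∀ᶠ δ in 𝓝[>] (0 : ℝ), ‖u δ‖ ≤ δ) → (∀ᶠ δ in 𝓝[>] (0 : ℝ), Nonempty (YangBaxterSAW (fun (_ : ℤ) => Real.pi / 2) ((D.map (similarity 1 one_ne_zero (u δ))).carrier) δ (a δ) (b δ))) → Tendsto (fun δ : ℝ => (δ : ℂ) * planeMidpoint (fun (_ : ℤ) => Real.pi / 2) (a δ)) (𝓝[>] (0 : ℝ)) (𝓝 (D.pt 0)) → Tendsto (fun δ : ℝ => (δ : ℂ) * planeMidpoint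 (fun (_ : ℤ) => Real.pi / 2) (b δ)) (𝓝[>] (0 : ℝ)) (𝓝 (D.pt 1)) → TendstoLaw (fun δ (γ : YangBaxterSAW (fun (_ : ℤ) => Real.pi / 2) ((D.map (similarity 1 one_ne_zero (u δ))).carrier) δ (a δ) (b δ)) => γ.curve (fun (_ : ℤ) => Real.pi / 2) δ) (fun δ => ybLaw (fun (_ : ℤ) => Real.pi / 2) ((D.map (similarity 1 one_ne_zero (u δ))).carrier) δ 1 (a δ) (b δ)) id (P D)) → SAWTrackTransport.AngleUniversality → SAWTrackTransport.YBtoUniform → ∀ P : ChordalFamily, P.IsChordal → (∀ (D : DobrushinDomain) (u : ℝ → ℂ) (a b : ℝ → MidEdge), (∀ᶠ δ in 𝓝[>] (0 : ℝ), ‖u δ‖ ≤ δ) → (∀ᶠ δ in 𝓝[>] (0 : ℝ), Nonempty (YangBaxterSAW (fun (_ : ℤ) => Real.pi / 3) ((D.map (similarity 1 one_ne_zero (u δ))).carrier) δ (a δ) (b δ))) → Tendsto (fun δ : ℝ => (δ : ℂ) * planeMidpoint (fun (_ : ℤ) => Real.pi / 3) (a δ)) (𝓝[>] (0 : ℝ))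 (𝓝 (D.pt 0)) → Tendsto (fun δ : ℝ => (δ : ℂ) * planeMidpoint (fun (_ : ℤ) => Real.pi / 3) (b δ)) (𝓝[>] (0 : ℝ)) (𝓝 (D.pt 1)) → TendstoLaw (fun δ (γ : YangBaxterSAW (fun (_ : ℤ) => Real.pi / 3) ((D.map (similarity 1 one_ne_zero (u δ))).carrier) δ (a δ) (b δ)) => γ.curve (fun (_ : ℤ) => Real.pi / 3) δ) (fun δ => ybLaw (fun (_ : ℤ) => Real.pi / 3) ((D.map (similarity 1 one_ne_zero (u δ))).carrier) δ 1 (a δ) (b δ)) id (P D)) → ∀ (D : DobrushinDomain) (a b : ℝ → HexVertex), SAW.IsEmbEndpointApprox hexGraph hexCenter D a b → TendstoLaw (fun δ (γ : SAW.HexDomainSAW D.carrier δ (a δ) (b δ)) => CurveClass.map (similarity I I_ne_zero 0 : C(ℂ, ℂ)) γ.curve) (fun δ => SAW.hexSAWLaw D.carrier δ (a δ) (b δ)) id (P (D.map (similarity I I_ne_zero 0))) :=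
  fun hU hL hAU h4 => hexVertexRobust_of_latticeUniversality hU hL hAU h4

end Summit.CriticalPhenomena.SAWScalingLimit.Cruxes.LatticeUniversality.Birth

end
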